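import Mathlib
import Summits.Ventures.HodgeRepro2.T5MuInvariantPadic
import Summits.Ventures.HodgeRepro2.T5AmiceIsometry
import Summits.Ventures.HodgeRepro2.T5AmiceInverse

/-!
# T5MuInvariantAmice — the μ-invariant of a measure is the μ-invariant of its power series

Cell pub-hodge-repro2, Tier 5 support (seat p7; route/T5-CHECK-G-p7.md §3 S4 / S5). §G computes the
μ-invariant of the measure `m := L⁻_{Σ,λ⁻¹,𝔭}` on `Γ_𝔭 ≅ ℤ_p` as «inf over opens» (S4, S1 — the
`mu` of T5MuInvariantPadic, p400202: `mu p m = ⨅ U clopen, v_p(m 1_U)`), and then reads `m` as the power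
series `f_m ∈ ℤ_p[[T]]` whose Weierstrass factorisation `f_m = p^μ · P · U` (S5, [P3]) carries the
μ-invariant of the POWER SERIES, `min_n v_p(coeff_n f_m)`. This file proves that the two numbers agree,
on the cell's measure model with `R = ℤ_p` (`m : C(ℤ_[p], ℤ_[p]) →ₗ[ℤ_[p]] ℤ_[p]` bounded):

* `mu_eq_iInf_vp_coeff`: `mu p m = ⨅ n, v_p(coeff_n f_m)` — from the Amice isometry
  (T5AmiceIsometry): `v_p(m φ) ≥ k` for every `φ` as soon as `v_p(coeff_n f_m) ≥ k` for every `n`;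
* `natCast_le_mu_iff_forall_pow_dvd_coeff`: `k ≤ μ(m) ⟺ p^k ∣ coeff_n f_m` for every `n`
  («`f_m ∈ p^k ℤ_p[[T]]`»);
* `mu_eq_zero_iff_exists_isUnit_coeff`: `μ(m) = 0 ⟺ some coefficient of `f_m` is a unit`
  («`f_m ≢ 0 mod p`»);
* `exists_amice_eq_pow_smul`: for `μ(m) = k < ∞`, `f_m = p^k · g` with `g ∈ ℤ_p[[T]]` having a unit
  coefficient — the normalisation «`f_m = p^μ · f′`, `μ(f′) = 0`» that precedes Weierstrass preparation;
* `exists_eq_pow_smul_of_mu_eq`: the same on the measure side, `m = p^k • m′` with `μ(m′) = 0`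
  (T5AmiceInverse's `ofCoeffs` builds `m′` from the coefficients of `g`).

Mathlib + own T5MuInvariantPadic, T5AmiceIsometry (hence T5AmiceTransform), T5AmiceInverse only.
-/

namespace Summit.Ventures.HodgeRepro2.T5MuInvariantAmice

open PadicInt Filter Topology
open Summit.Ventures.HodgeRepro2.T5AmiceTransform
open Summit.Ventures.HodgeRepro2.T5AmiceIsometry
open Summit.Ventures.HodgeRepro2.T5MuInvariantPadic

variable {p : ℕ} [hp : Fact p.Prime]

/-! ### Valuation facts on `ℤ_p` -/

/-- `vp p x = 0 ⟺ x` is a unit of `ℤ_p`. -/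
theorem vp_eq_zero_iff_isUnit (x : ℤ_[p]) : vp p x = 0 ↔ IsUnit x := by
  constructor
  · intro h
    have hx : x ≠ 0 := by
      rintro rfl
      rw [vp_zero] at h
      exact ENat.top_ne_zero h
    rw [vp_of_ne_zero p hx, Nat.cast_eq_zero] at h
    rw [PadicInt.isUnit_iff, norm_eq_zpow_neg_valuation hx, h]
    simp
  · intro hu
    have hn : ‖x‖ = 1 := PadicInt.isUnit_iff.mp hu
    have hx : x ≠ 0 := by
      rintro rfl
      simp at hn
    rw [vp_of_ne_zero p hx, Nat.cast_eq_zero]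
    by_contra hv
    have h1 : 1 ≤ x.valuation := Nat.one_le_iff_ne_zero.mpr hv
    have hle : ‖x‖ ≤ (p : ℝ) ^ (-(1 : ℕ) : ℤ) := (norm_le_pow_iff_le_valuation x hx 1).mpr h1
    have hp1 : (1 : ℝ) < p := by exact_mod_cast hp.out.one_lt
    have hlt : (p : ℝ) ^ (-(1 : ℕ) : ℤ) < 1 := by
      rw [zpow_neg, zpow_natCast, pow_one]
      exact inv_lt_one_of_one_lt₀ hp1
    linarith

/-- `k ≤ vp p x ⟺ p^k ∣ x` (the valuation counts the power of `p` dividing `x`). -/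
theorem natCast_le_vp_iff_pow_dvd (x : ℤ_[p]) (k : ℕ) :
    (k : ℕ∞) ≤ vp p x ↔ (p : ℤ_[p]) ^ k ∣ x := by
  rw [← norm_le_pow_iff p x k, norm_le_pow_iff_mem_span_pow, Ideal.mem_span_singleton]

/-- `vp p (p^k * c) = k + vp p c`. -/
theorem vp_pow_mul (k : ℕ) (c : ℤ_[p]) : vp p ((p : ℤ_[p]) ^ k * c) = k + vp p c := by
  rcases eq_or_ne c 0 with rfl | hc
  · simp [vp_zero]
  · have hpk : ((p : ℤ_[p]) ^ k * c) ≠ 0 :=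
      mul_ne_zero (pow_ne_zero _ (Nat.cast_ne_zero.mpr hp.out.ne_zero)) hc
    rw [vp_of_ne_zero p hpk, vp_of_ne_zero p hc, valuation_p_pow_mul k c hc]
    push_cast
    rfl

/-! ### The two μ-invariants agree -/

variable (m : C(ℤ_[p], ℤ_[p]) →ₗ[ℤ_[p]] ℤ_[p]) {C : ℝ}

/-- Every `φ ∈ C(ℤ_p, ℤ_p)` has `‖φ‖ ≤ 1`. -/
theorem norm_le_one' (φ : C(ℤ_[p], ℤ_[p])) : ‖φ‖ ≤ 1 :=
  (ContinuousMap.norm_le φ zero_le_one).mpr fun x => PadicInt.norm_le_one (φ x)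

/-- If `k ≤ v_p(coeff_n f_m)` for every `n`, then `k ≤ v_p(m φ)` for every `φ` (the Amice isometry,
read in valuations). -/
theorem natCast_le_vp_apply_of_forall_coeff (hb : ∀ φ, ‖m φ‖ ≤ C * ‖φ‖) (k : ℕ)
    (h : ∀ n, (k : ℕ∞) ≤ vp p (PowerSeries.coeff n (amice m))) (φ : C(ℤ_[p], ℤ_[p])) :
    (k : ℕ∞) ≤ vp p (m φ) := by
  rw [← norm_le_pow_iff]
  have hm : Continuous m := continuous_of_bound m C hb
  have hk : ∀ n, ‖PowerSeries.coeff n (amice m)‖ ≤ (p : ℝ) ^ (-(k : ℤ)) := fun n =>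
    (norm_le_pow_iff p _ k).mpr (h n)
  have h0 : (0 : ℝ) ≤ (p : ℝ) ^ (-(k : ℤ)) := zpow_nonneg (Nat.cast_nonneg p) _
  calc ‖m φ‖ ≤ (p : ℝ) ^ (-(k : ℤ)) * ‖φ‖ := norm_map_le_of_forall_norm_coeff_le m hm h0 hk φ
    _ ≤ (p : ℝ) ^ (-(k : ℤ)) * 1 := by gcongr; exact norm_le_one' φ
    _ = (p : ℝ) ^ (-(k : ℤ)) := mul_one _

/-- `⨅ φ, v_p(m φ) = ⨅ n, v_p(coeff_n f_m)`: the infimum over all test functions is the infimum over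
the Mahler basis. -/
theorem iInf_vp_apply_eq_iInf_vp_coeff (hb : ∀ φ, ‖m φ‖ ≤ C * ‖φ‖) :
    ⨅ φ, vp p (m φ) = ⨅ n, vp p (PowerSeries.coeff n (amice m)) := by
  apply le_antisymm
  · refine le_iInf fun n => ?_
    rw [coeff_amice]
    exact iInf_le _ _
  · refine le_iInf fun φ => ?_
    refine le_of_forall_natCast_le fun k hk => ?_
    exact natCast_le_vp_apply_of_forall_coeff m hb k (fun n => hk.trans (iInf_le _ n)) φ

/-- THE TWO μ-INVARIANTS AGREE: `mu p m = ⨅ n, v_p(coeff_n f_m)` — S4's «inf over opens» is S5's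
«min valuation of the coefficients of `f_m`». -/
theorem mu_eq_iInf_vp_coeff (hC : 0 ≤ C) (hb : ∀ φ, ‖m φ‖ ≤ C * ‖φ‖) :
    mu p m = ⨅ n, vp p (PowerSeries.coeff n (amice m)) := by
  rw [← iInf_vp_apply_eq_mu p m hC hb, iInf_vp_apply_eq_iInf_vp_coeff m hb]

/-- `k ≤ μ(m) ⟺ p^k` divides every coefficient of `f_m` («`f_m ∈ p^k ℤ_p[[T]]`»). -/
theorem natCast_le_mu_iff_forall_pow_dvd_coeff (hC : 0 ≤ C) (hb : ∀ φ, ‖m φ‖ ≤ C * ‖φ‖) (k : ℕ) :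
    (k : ℕ∞) ≤ mu p m ↔ ∀ n, (p : ℤ_[p]) ^ k ∣ PowerSeries.coeff n (amice m) := by
  rw [mu_eq_iInf_vp_coeff m hC hb, le_iInf_iff]
  exact forall_congr' fun n => natCast_le_vp_iff_pow_dvd _ k

/-- `μ(m) = 0 ⟺` some coefficient of `f_m` is a unit («`f_m ≢ 0 mod p`»). -/
theorem mu_eq_zero_iff_exists_isUnit_coeff (hC : 0 ≤ C) (hb : ∀ φ, ‖m φ‖ ≤ C * ‖φ‖) :
    mu p m = 0 ↔ ∃ n, IsUnit (PowerSeries.coeff n (amice m)) := by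
  rw [mu_eq_iInf_vp_coeff m hC hb, ENat.iInf_eq_zero]
  exact exists_congr fun n => vp_eq_zero_iff_isUnit _

/-- `μ(m) = ⊤ ⟺ f_m = 0` (consistent with `mu_eq_top_iff_eq_zero` and `amice_eq_zero_iff`). -/
theorem mu_eq_top_iff_amice_eq_zero (hC : 0 ≤ C) (hb : ∀ φ, ‖m φ‖ ≤ C * ‖φ‖) :
    mu p m = ⊤ ↔ amice m = 0 := by
  rw [mu_eq_iInf_vp_coeff m hC hb, iInf_eq_top]
  constructor
  · intro h
    ext n
    simpa [vp_eq_top_iff] using h n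
  · intro h n
    rw [h, map_zero, vp_zero]

/-- A finite infimum over `ℕ` in `ℕ∞` is attained: if `μ(m) = k < ∞` then some coefficient of `f_m`
has valuation exactly `k`. -/
theorem exists_vp_coeff_eq_of_mu_eq (hC : 0 ≤ C) (hb : ∀ φ, ‖m φ‖ ≤ C * ‖φ‖) (k : ℕ)
    (hk : mu p m = k) : ∃ n, vp p (PowerSeries.coeff n (amice m)) = k := by
  rw [mu_eq_iInf_vp_coeff m hC hb] at hk
  have hmem := csInf_mem (Set.range_nonempty fun n => vp p (PowerSeries.coeff n (amice m)))
  rw [← sInf_range] at hk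
  rw [hk] at hmem
  obtain ⟨n, hn⟩ := hmem
  exact ⟨n, hn⟩

/-- NORMALISATION before Weierstrass: if `μ(m) = k < ∞` then `f_m = p^k · g` with `g ∈ ℤ_p[[T]]` having a
unit coefficient (`μ(g) = 0`). -/
theorem exists_amice_eq_pow_smul (hC : 0 ≤ C) (hb : ∀ φ, ‖m φ‖ ≤ C * ‖φ‖) (k : ℕ)
    (hk : mu p m = k) :
    ∃ g : PowerSeries ℤ_[p], amice m = (p : ℤ_[p]) ^ k • g ∧
      (∀ n, ‖PowerSeries.coeff n g‖ ≤ 1) ∧ ∃ n, IsUnit (PowerSeries.coeff n g) := by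
  have hdvd : ∀ n, (p : ℤ_[p]) ^ k ∣ PowerSeries.coeff n (amice m) :=
    (natCast_le_mu_iff_forall_pow_dvd_coeff m hC hb k).mp hk.ge
  choose c hc using hdvd
  refine ⟨PowerSeries.mk c, ?_, fun n => by simpa using PadicInt.norm_le_one (c n), ?_⟩
  · ext n
    simp [hc n]
  · obtain ⟨n, hn⟩ := exists_vp_coeff_eq_of_mu_eq m hC hb k hk
    refine ⟨n, ?_⟩
    rw [PowerSeries.coeff_mk, ← vp_eq_zero_iff_isUnit]
    rw [hc n, vp_pow_mul] at hn
    have : (k : ℕ∞) + vp p (c n) = (k : ℕ∞) + 0 := by rw [hn, add_zero]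
    exact WithTop.add_left_cancel (WithTop.natCast_ne_top k) this

/-- NORMALISATION on the measure side: if `μ(m) = k < ∞` then `m = p^k • m′` for a bounded `m′` with
`μ(m′) = 0` (the «`L = p^μ · L′`, `μ(L′) = 0`» of S5, as measures). -/
theorem exists_eq_pow_smul_of_mu_eq (hC : 0 ≤ C) (hb : ∀ φ, ‖m φ‖ ≤ C * ‖φ‖) (k : ℕ)
    (hk : mu p m = k) :
    ∃ m' : C(ℤ_[p], ℤ_[p]) →ₗ[ℤ_[p]] ℤ_[p],
      (∀ φ, ‖m' φ‖ ≤ 1 * ‖φ‖) ∧ m = (p : ℤ_[p]) ^ k • m' ∧ mu p m' = 0 := by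
  obtain ⟨g, hg, hg1, n, hn⟩ := exists_amice_eq_pow_smul m hC hb k hk
  set m' := Summit.Ventures.HodgeRepro2.T5AmiceInverse.ofCoeffs p (fun n => PowerSeries.coeff n g) hg1
    with hm'
  have hb' : ∀ φ, ‖m' φ‖ ≤ 1 * ‖φ‖ := fun φ =>
    Summit.Ventures.HodgeRepro2.T5AmiceInverse.norm_ofCoeffs_le _ hg1 φ
  have hamice : amice m' = g := by
    rw [hm', Summit.Ventures.HodgeRepro2.T5AmiceInverse.amice_ofCoeffs]
    ext n
    simp
  refine ⟨m', hb', ?_, ?_⟩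
  · apply eq_of_amice_eq (continuous_of_bound m C hb)
    · have : ⇑((p : ℤ_[p]) ^ k • m') = fun φ => (p : ℤ_[p]) ^ k • m' φ := rfl
      rw [this]
      exact (continuous_of_bound m' 1 hb').const_smul ((p : ℤ_[p]) ^ k)
    · rw [amice_smul, hamice, hg]
  · rw [mu_eq_zero_iff_exists_isUnit_coeff m' zero_le_one hb', hamice]
    exact ⟨n, hn⟩

end Summit.Ventures.HodgeRepro2.T5MuInvariantAmice
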